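import Literature.MathematicalPhysics.QuantumLattice.LatticeGaugeDLR
import HarnessLib

/-!
# The discrete Poincaré lemma on `ℤ^d`: a lattice 1-form with zero plaquette curl is a gradient
# (gauge-boot, L3 structural supplement; `ℤ^d` tools)

HONEST FRAMING (cell `pub-gaugeboot`, page 1 of every file): the venture produces certified bounds
on lattice expectations at stated coupling, gauge group, dimension and torus size; NOT a mass gap,
NOT a continuum limit, NOT a string tension; NOT Yang–Mills-summit-bearing (barriers
`FixedCouplingUltralocality`, `PerturbativeInvisibility`). This module bounds no expectation: it is
lattice combinatorics (`H¹` of the cubical complex `ℤ^d` vanishes), used by the sequel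
`ZdCentralTwistGaugeEquivalence.lean` (any two Kogut–Susskind staggerings of `ℤ^d` with the same
central value are gauge equivalent; `ZdCentralTwistSymmetries.lean` had the quadratic special case).

Objects (namespace `ZdPoincare`; `A` any additive commutative group; links `ZdEdge d = Site d × Fin d`
of the tree's `LatticeGaugeDLR`, the link `(x, m)` joining `x` to `x + e_m`):
* `latticeGrad φ (x, m) = φ(x + e_m) - φ(x)` — the gradient of a 0-form;
  `IsCurlFree c` — zero lattice curl: `c(x,k) + c(x + e_k, l) = c(x,l) + c(x + e_l, k)` on every plaquette;
  `isCurlFree_latticeGrad` (`curl ∘ grad = 0`);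
* `zsum f n` — the signed sum `∑_{0 ≤ u < n} f u` (`n ≥ 0`) / `-∑_{n ≤ u < 0} f u` (`n < 0`), with
  `zsum_succ : zsum f (n+1) = zsum f n + f n` for EVERY `n : ℤ`, `zsum_sub`, `zsum_telescope`;
* `corner a x u = (x_0, …, x_{a-1}, u, 0, …, 0)`, `trunc k x = (x_0, …, x_{k-1}, 0, …, 0)` — the
  lexicographic staircase from `0` to `x`; `potential c x = ∑_a zsum (u ↦ c(corner a x u, a)) (x_a)` —
  the line sum of `c` along it;
* ★★ `potential_add_single` — **for closed `c`, `potential c (x + e_m) = potential c x + c(x, m)`**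
  (two telescopings: along each later segment by flatness, then across the segments), i.e.
  ★★ `latticeGrad_potential : latticeGrad (potential c) = c`; `isCurlFree_iff_exists_latticeGrad`;
* `eq_of_forall_add_single` — a 0-form with zero gradient is constant (`ℤ^d` is connected), so the
  potential is unique up to a constant (`eq_add_const_of_latticeGrad_eq`).

[folklore] bookkeeping (the cubical Poincaré lemma / axial gauge; e.g. Seiler, LNP 159 (1982) Ch. 1,
gauge fixing on the lattice). No measure, no bound.
-/

namespace Summit.QuantumFields.GaugeBoot

open Literature.Probability.LatticeModels (Site)
open Literature.MathematicalPhysics.QuantumLattice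

namespace ZdPoincare

variable {d : ℕ} {A : Type*} [AddCommGroup A]

/-! ## Lattice gradient and lattice curl -/

/-- **The lattice gradient** of a 0-form: `(grad φ)(x, m) = φ(x + e_m) - φ(x)`. -/
def latticeGrad (φ : Site d → A) : ZdEdge d → A :=
  fun e => φ (e.1 + Pi.single e.2 1) - φ e.1

/-- `latticeGrad` evaluated. -/
@[simp] theorem latticeGrad_apply (φ : Site d → A) (x : Site d) (m : Fin d) :
    latticeGrad φ (x, m) = φ (x + Pi.single m 1) - φ x := rfl

/-- **Zero lattice curl** (a closed / flat 1-form): around every plaquette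
`c(x, k) + c(x + e_k, l) = c(x, l) + c(x + e_l, k)`. [shape] A hypothesis (a `Prop`), asserting
nothing. [folklore] -/
def IsCurlFree (c : ZdEdge d → A) : Prop :=
  ∀ (x : Site d) (k l : Fin d), c (x, k) + c (x + Pi.single k 1, l) = c (x, l) + c (x + Pi.single l 1, k)

/-- **`curl ∘ grad = 0`**: every gradient is closed. -/
theorem isCurlFree_latticeGrad (φ : Site d → A) : IsCurlFree (latticeGrad φ) := by
  intro x k l
  simp only [latticeGrad_apply, add_right_comm x (Pi.single k (1 : ℤ)) (Pi.single l 1)]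
  abel

/-! ## Signed sums over integer intervals -/

/-- **The signed interval sum** `zsum f n`: `∑_{0 ≤ u < n} f u` for `n ≥ 0` and `-∑_{n ≤ u < 0} f u`
for `n < 0` (so that `zsum f (n + 1) = zsum f n + f n` for every integer `n`). -/
def zsum (f : ℤ → A) : ℤ → A
  | Int.ofNat k => ∑ u ∈ Finset.range k, f u
  | Int.negSucc k => -∑ u ∈ Finset.range (k + 1), f (Int.negSucc u)

/-- `zsum f 0 = 0`. -/
@[simp] theorem zsum_zero (f : ℤ → A) : zsum f 0 = 0 := by
  show ∑ u ∈ Finset.range 0, f u = 0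
  simp

/-- `zsum` at a natural number. -/
theorem zsum_natCast (f : ℤ → A) (k : ℕ) : zsum f k = ∑ u ∈ Finset.range k, f u := rfl

/-- `zsum` at `-(k+1)`. -/
theorem zsum_negSucc (f : ℤ → A) (k : ℕ) :
    zsum f (Int.negSucc k) = -∑ u ∈ Finset.range (k + 1), f (Int.negSucc u) := rfl

/-- ★ **The step rule, every integer**: `zsum f (n + 1) = zsum f n + f n`. -/
theorem zsum_succ (f : ℤ → A) (n : ℤ) : zsum f (n + 1) = zsum f n + f n := by
  rcases n with k | k
  · show zsum f ((k + 1 : ℕ) : ℤ) = zsum f (k : ℕ) + f (k : ℕ)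
    rw [zsum_natCast, zsum_natCast, Finset.sum_range_succ]
  · rcases k with _ | j
    · show zsum f 0 = zsum f (Int.negSucc 0) + f (Int.negSucc 0)
      rw [zsum_zero, zsum_negSucc, Finset.sum_range_one, neg_add_cancel]
    · show zsum f (Int.negSucc j) = zsum f (Int.negSucc (j + 1)) + f (Int.negSucc (j + 1))
      rw [zsum_negSucc, zsum_negSucc, Finset.sum_range_succ (fun u => f (Int.negSucc u)) (j + 1)]
      abel

/-- The step rule downwards: `zsum f (n - 1) = zsum f n - f (n - 1)`. -/
theorem zsum_pred (f : ℤ → A) (n : ℤ) : zsum f (n - 1) = zsum f n - f (n - 1) := by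
  have h := zsum_succ f (n - 1)
  rw [sub_add_cancel] at h
  rw [h, add_sub_cancel_right]

/-- `zsum` is additive in `f` (pointwise difference). -/
theorem zsum_sub (f g : ℤ → A) (n : ℤ) :
    zsum (fun u => f u - g u) n = zsum f n - zsum g n := by
  induction n using Int.induction_on with
  | zero => simp
  | succ k ih => rw [zsum_succ, zsum_succ, zsum_succ, ih]; abel
  | pred k ih =>
    rw [zsum_pred, zsum_pred, zsum_pred, ih]
    abel

/-- **Telescoping**: `zsum (u ↦ g(u+1) - g u) n = g n - g 0`, every integer `n`. -/
theorem zsum_telescope (g : ℤ → A) (n : ℤ) : zsum (fun u => g (u + 1) - g u) n = g n - g 0 := by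
  induction n using Int.induction_on with
  | zero => simp
  | succ k ih => rw [zsum_succ, ih]; abel
  | pred k ih =>
    rw [zsum_pred, ih, sub_add_cancel]
    abel

/-- `zsum` depends only on the values of `f` (pointwise congruence). -/
theorem zsum_congr {f g : ℤ → A} (h : ∀ u, f u = g u) (n : ℤ) : zsum f n = zsum g n := by
  rw [show f = g from funext h]

/-! ## The lexicographic staircase and the potential -/

/-- **Corner points of the staircase**: `corner a x u = (x_0, …, x_{a-1}, u, 0, …, 0)`. -/
def corner (a : Fin d) (x : Site d) (u : ℤ) : Site d :=
  fun b => if b < a then x b else if b = a then u else 0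

/-- **Truncations**: `trunc k x = (x_0, …, x_{k-1}, 0, …, 0)` (`k : ℕ`; `trunc d x = x`, `trunc 0 x = 0`). -/
def trunc (k : ℕ) (x : Site d) : Site d := fun b => if (b : ℕ) < k then x b else 0

/-- `trunc d x = x`. -/
@[simp] theorem trunc_self (x : Site d) : trunc d x = x := by
  funext b; simp [trunc, b.isLt]

/-- The staircase segment `a` starts at `trunc a x`. -/
theorem corner_zero (a : Fin d) (x : Site d) : corner a x 0 = trunc a x := by
  funext b
  simp only [corner, trunc, Fin.lt_def]
  by_cases h1 : (b : ℕ) < a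
  · rw [if_pos h1, if_pos h1]
  · rw [if_neg h1, if_neg h1, ite_self]

/-- The staircase segment `a` ends at `trunc (a+1) x`. -/
theorem corner_self (a : Fin d) (x : Site d) : corner a x (x a) = trunc (a + 1) x := by
  funext b
  simp only [corner, trunc, Fin.lt_def]
  by_cases h1 : (b : ℕ) < a
  · rw [if_pos h1, if_pos (Nat.lt_succ_of_lt h1)]
  · by_cases h2 : b = a
    · subst h2; rw [if_neg h1, if_pos rfl, if_pos (Nat.lt_succ_self _)]
    · rw [if_neg h1, if_neg h2, if_neg]
      intro h; exact h2 (Fin.ext (by omega))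

/-- One step along segment `a`: `corner a x u + e_a = corner a x (u + 1)`. -/
theorem corner_add_one (a : Fin d) (x : Site d) (u : ℤ) :
    corner a x u + Pi.single a 1 = corner a x (u + 1) := by
  funext b
  simp only [corner, Pi.add_apply, Pi.single_apply]
  by_cases h1 : b < a
  · rw [if_pos h1, if_pos h1, if_neg (ne_of_lt h1), add_zero]
  · by_cases h2 : b = a
    · subst h2; simp
    · rw [if_neg h1, if_neg h2, if_neg h1, if_neg h2, if_neg h2, add_zero]

/-- Shifting `x` by `e_m` does not move the segments `a ≤ m` (they only read `x_b`, `b < a`). -/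
theorem corner_add_single_of_le {a m : Fin d} (ham : a ≤ m) (x : Site d) (u : ℤ) :
    corner a (x + Pi.single m 1) u = corner a x u := by
  funext b
  simp only [corner, Pi.add_apply, Pi.single_apply]
  by_cases h1 : b < a
  · rw [if_pos h1, if_pos h1, if_neg (ne_of_lt (lt_of_lt_of_le h1 ham)), add_zero]
  · rw [if_neg h1, if_neg h1]

/-- Shifting `x` by `e_m` translates the later segments `a > m` by `e_m`. -/
theorem corner_add_single_of_lt {a m : Fin d} (hma : m < a) (x : Site d) (u : ℤ) :
    corner a (x + Pi.single m 1) u = corner a x u + Pi.single m 1 := by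
  funext b
  simp only [corner, Pi.add_apply, Pi.single_apply]
  by_cases h1 : b < a
  · rw [if_pos h1, if_pos h1]
  · have hbm : b ≠ m := fun h => h1 (h ▸ hma)
    rw [if_neg h1, if_neg h1, if_neg hbm, add_zero]

/-- **The potential**: the line sum of `c` along the lexicographic staircase from `0` to `x`,
`potential c x = ∑_a zsum (u ↦ c(corner a x u, a)) (x_a)`. -/
def potential (c : ZdEdge d → A) (x : Site d) : A :=
  ∑ a : Fin d, zsum (fun u => c (corner a x u, a)) (x a)

/-- Telescoping across the segments: `∑_{k < n, m < k} (F(k+1) - F k) = F n - F (m+1)` (`m + 1 ≤ n`). -/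
theorem sum_range_ite_lt_sub (F : ℕ → A) (m : ℕ) :
    ∀ n, m + 1 ≤ n → ∑ k ∈ Finset.range n, (if m < k then F (k + 1) - F k else 0) = F n - F (m + 1)
  | 0, h => absurd h (by omega)
  | n + 1, h => by
    rw [Finset.sum_range_succ]
    rcases Nat.eq_or_lt_of_le h with h' | h'
    · -- `n = m`: all earlier terms vanish
      have hn : n = m := by omega
      subst hn
      rw [if_neg (lt_irrefl _), add_zero, sub_self]
      exact Finset.sum_eq_zero fun k hk => if_neg (by simp at hk; omega)
    · rw [sum_range_ite_lt_sub F m n (by omega), if_pos (by omega)]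
      abel

/-- ★★ **The potential integrates the closed 1-form**: `potential c (x + e_m) = potential c x + c(x, m)`. -/
theorem potential_add_single {c : ZdEdge d → A} (hc : IsCurlFree c) (x : Site d) (m : Fin d) :
    potential c (x + Pi.single m 1) = potential c x + c (x, m) := by
  -- the difference, segment by segment
  set F : ℕ → A := fun k => c (trunc k x, m) with hF
  have hD : ∀ a : Fin d,
      zsum (fun u => c (corner a (x + Pi.single m 1) u, a)) ((x + Pi.single m 1 : Site d) a) -
        zsum (fun u => c (corner a x u, a)) (x a) =
      (if a = m then F (m + 1) else 0) + if (m : ℕ) < a then F (a + 1) - F a else 0 := by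
    intro a
    rcases lt_trichotomy a m with ham | rfl | hma
    · -- earlier segment: unchanged
      rw [if_neg (ne_of_lt ham), if_neg (not_lt.2 (le_of_lt (Fin.lt_def.1 ham))), add_zero,
        Pi.add_apply, Pi.single_eq_of_ne (ne_of_lt ham), add_zero]
      rw [zsum_congr (fun u => by rw [corner_add_single_of_le (le_of_lt ham)]), sub_self]
    · -- the segment of the shifted axis: one more step
      rw [if_pos rfl, if_neg (lt_irrefl _), add_zero, Pi.add_apply, Pi.single_eq_same,
        zsum_congr (fun u => by rw [corner_add_single_of_le (le_refl a)]), zsum_succ,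
        add_sub_cancel_left, hF, corner_self]
    · -- later segment: translated by `e_m`; flatness moves the difference to the `m`-links
      rw [if_neg (ne_of_gt hma), if_pos (Fin.lt_def.1 hma), zero_add, Pi.add_apply,
        Pi.single_eq_of_ne (ne_of_gt hma), add_zero,
        zsum_congr (fun u => by rw [corner_add_single_of_lt hma]), ← zsum_sub]
      have hflat : ∀ u : ℤ, c (corner a x u + Pi.single m 1, a) - c (corner a x u, a) =
          c (corner a x (u + 1), m) - c (corner a x u, m) := by
        intro u
        have h := hc (corner a x u) m a
        rw [corner_add_one] at h
        -- `c(p,m) + c(p+e_m,a) = c(p,a) + c(p+e_a,m)`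
        exact (sub_eq_sub_iff_add_eq_add.2 (by rw [add_comm (c _ ) (c _)] at h; rw [add_comm]; exact h.symm)).symm
      rw [zsum_congr hflat, zsum_telescope (fun u => c (corner a x u, m)), corner_self, corner_zero]
  -- sum over the segments
  have hsum : potential c (x + Pi.single m 1) - potential c x = c (x, m) := by
    unfold potential
    rw [← Finset.sum_sub_distrib, Finset.sum_congr rfl fun a _ => hD a, Finset.sum_add_distrib,
      Finset.sum_ite_eq' Finset.univ m, if_pos (Finset.mem_univ m)]
    rw [Fin.sum_univ_eq_sum_range (fun k => if (m : ℕ) < k then F (k + 1) - F k else 0) d,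
      sum_range_ite_lt_sub F m d (by have := m.isLt; omega), hF]
    simp only [trunc_self, add_sub_cancel]
  rw [← hsum, add_sub_cancel]

/-- ★★ **The discrete Poincaré lemma on `ℤ^d`**: the gradient of the potential of a closed 1-form is
the form. -/
theorem latticeGrad_potential {c : ZdEdge d → A} (hc : IsCurlFree c) : latticeGrad (potential c) = c := by
  funext e
  obtain ⟨x, m⟩ := e
  rw [latticeGrad_apply, potential_add_single hc, add_sub_cancel_left]

/-- **Closed iff exact** on `ℤ^d` (`H¹(ℤ^d) = 0` for the cubical complex). -/
theorem isCurlFree_iff_exists_latticeGrad (c : ZdEdge d → A) :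
    IsCurlFree c ↔ ∃ φ : Site d → A, latticeGrad φ = c :=
  ⟨fun hc => ⟨potential c, latticeGrad_potential hc⟩, fun ⟨φ, hφ⟩ => hφ ▸ isCurlFree_latticeGrad φ⟩

/-! ## Uniqueness of the potential up to a constant -/

omit [AddCommGroup A] in
/-- **A 0-form invariant under every unit translation is constant** (`ℤ^d` is connected; the path is
the lexicographic staircase). -/
theorem eq_of_forall_add_single {h : Site d → A} (hh : ∀ (x : Site d) (m : Fin d),
    h (x + Pi.single m 1) = h x) (x : Site d) : h x = h 0 := by
  -- along each segment `h` is constant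
  have hseg : ∀ (a : Fin d) (u : ℤ), h (corner a x u) = h (corner a x 0) := by
    intro a u
    induction u using Int.induction_on with
    | zero => rfl
    | succ k ih => rw [← corner_add_one, hh, ih]
    | pred k ih =>
      have h1 := hh (corner a x (-(k : ℤ) - 1)) a
      rw [corner_add_one, sub_add_cancel] at h1
      rw [← h1, ih]
  -- across the segments: `h (trunc k x)` is independent of `k`
  have htr : ∀ k : ℕ, k ≤ d → h (trunc k x) = h (trunc 0 x) := by
    intro k hk
    induction k with
    | zero => rfl
    | succ k ih =>
      have ha : k < d := hk
      have h1 := hseg ⟨k, ha⟩ (x ⟨k, ha⟩)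
      rw [corner_self, corner_zero] at h1
      exact h1.trans (ih ha.le)
  have h0 : trunc 0 x = (0 : Site d) := by funext b; simp [trunc]
  rw [← trunc_self x, htr d le_rfl, h0]

/-- **The potential is unique up to a constant**: two 0-forms with the same gradient differ by a
constant. -/
theorem eq_add_const_of_latticeGrad_eq {φ ψ : Site d → A} (hφψ : latticeGrad φ = latticeGrad ψ)
    (x : Site d) : φ x = ψ x + (φ 0 - ψ 0) := by
  have hh : ∀ (y : Site d) (m : Fin d), (φ - ψ) (y + Pi.single m 1) = (φ - ψ) y := by
    intro y m
    have h1 := congrFun hφψ (y, m)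
    simp only [latticeGrad_apply] at h1
    simp only [Pi.sub_apply]
    exact sub_eq_sub_iff_sub_eq_sub.1 h1
  have h2 := eq_of_forall_add_single hh x
  simp only [Pi.sub_apply] at h2
  rw [← h2, add_sub_cancel]

end ZdPoincare

end Summit.QuantumFields.GaugeBoot
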